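import Summits.Ventures.GridStability.Lyapunov.StructurePreservingRateRoa
import HarnessLib

/-!
# GridStability/Lyapunov/StructurePreservingRateState — «SP-RATE», state form: every bus angle and
# every generator frequency deviation of the structure-preserving model converges EXPONENTIALLY, at the
# closed-form rate `vhRate/2`, on the certified region of record (Khalil's Definition 4.5 inside `S`)

Cell `gridfusion` (LADDER-GRIDFUSION), seat gridfusion-lyap-1 (g7), brief «SP-RATE»; sequel of
`StructurePreservingRateRoa.lean` (`phaseEnergy_le_mul_exp_neg_of_sublevel`: the energy of record decays
like `3·vhGain·V(0)·e^{−vhRate·t}` along every solution from `S = {V ≤ c < c⋆(θ, β)} ∩ window ∩ leaf`).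
Here the energy bound is turned into bounds on the STATE of MODEL MV-3 — the sentence «frequency
synchronisation is exponential with an explicit rate» in coordinates:

* `D_mul_sq_le_vhGain_div_mul_phaseEnergy` — on the closed window ∩ momentum leaf,
  `Dᵢ·(δᵢ − δ₀ᵢ)² ≤ (vhGain/h)·V` (leaf Poincaré bound + `g(θ)·Q ≤ W`; `h·(4n²ΣD/β)/g ≤ vhGain`,
  `2hΣ_gen M/ΣD ≤ vhGain`) — the energy of record controls every ABSOLUTE angle deviation on the leaf;
* **`abs_angle_sub_le_of_sublevel`** — along every global solution `X` from `S`, for all `t ≥ 0` and every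
  bus `i`: `|δᵢ(t) − δ₀ᵢ| ≤ vhGain·√(3V(X 0)/(h·Dᵢ))·e^{−(vhRate/2)t}`;
* **`abs_speed_le_of_sublevel`** — for every generator `i`: `|ωᵢ(t)| ≤ √(6·vhGain·V(X 0)/Mᵢ)·e^{−(vhRate/2)t}`;
* `abs_sub_le_of_isSolution` — both bounds read on model-2's printed second-order solutions
  `p.shifted.IsSolution δ` (angles `δᵢ(t)`, generator speeds `δ̇ᵢ(t)`) [cite: Padiyar2013, §3.2 eqs (3.2)–(3.5)].

THREE COLUMNS: mathematics about MODEL MV-3 (any `n`, graph, damping pattern); `vhRate/2` is a certified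
LOWER bound on the exponential rate of the state inside `S`; no certificate data; no sentence here says a
grid is stable or well damped. No definition, no named fact; standard axioms.
[cite: Khalil2002, Theorem 4.10 and Definition 4.5]
-/

noncomputable section

open Set Filter Topology Real Finset
open Summit.Ventures.GridStability.Models.StructurePreserving
open Summit.Ventures.GridStability.Models.StructurePreserving.Params
open Literature.MathematicalPhysics.PowerSystems (SinusoidalCoupling.sectorGain_pos)

namespace Summit.Ventures.GridStability.Lyapunov.StructurePreserving

variable {n : ℕ}

/-! ### An elementary square-root step -/

/-- From `a² ≤ B·e^{−ρt}` with `B ≥ 0`: `|a| ≤ √B·e^{−(ρ/2)t}`. [folklore] -/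
theorem abs_le_sqrt_mul_exp_of_sq_le {a B ρ t : ℝ} (hB : 0 ≤ B)
    (h : a ^ 2 ≤ B * Real.exp (-ρ * t)) : |a| ≤ Real.sqrt B * Real.exp (-(ρ / 2) * t) := by
  have hexp : Real.exp (-ρ * t) = Real.exp (-(ρ / 2) * t) ^ 2 := by
    rw [sq, ← Real.exp_add]
    ring_nf
  have hnn : 0 ≤ Real.sqrt B * Real.exp (-(ρ / 2) * t) :=
    mul_nonneg (Real.sqrt_nonneg _) (Real.exp_pos _).le
  have hsq : a ^ 2 ≤ (Real.sqrt B * Real.exp (-(ρ / 2) * t)) ^ 2 := by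
    rw [mul_pow, Real.sq_sqrt hB, ← hexp]
    exact h
  exact abs_le_of_sq_le_sq hsq hnn

/-! ### The energy of record controls every absolute angle deviation on the leaf -/

/-- **`Dᵢ·φᵢ² ≤ (vhGain/h)·V` on the closed window ∩ momentum leaf** (`φ = δ − δ₀`; well-formed data on
`n ≠ 0` buses, susceptive couplings with `bᵢⱼ ≥ β > 0` on the edges of a preconnected coupling graph,
`|σ*| ≤ θ < π/2`, `0 < h`): `Dᵢφᵢ² ≤ Φ ≤ (4n²ΣD/β)Q + (2Σ_gen M/ΣD)K` (leaf Poincaré bound), `g(θ)Q ≤ W`,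
and `h·(4n²ΣD/β)/g ≤ vhGain`, `h·(2Σ_gen M/ΣD) ≤ vhGain`. [folklore] -/
theorem D_mul_sq_le_vhGain_div_mul_phaseEnergy {p : Params n} (hp : p.WellFormed) (hn : n ≠ 0)
    (hconn : p.couplingGraph.Preconnected) (hb : ∀ i j, 0 ≤ p.b i j) {β : ℝ} (hβ : 0 < β)
    (hβb : ∀ i j, p.couplingGraph.Adj i j → β ≤ p.b i j)
    {δ₀ : Fin n → ℝ} {θ : ℝ} (hθ0 : 0 ≤ θ) (hθ : θ < π / 2)
    (h0 : ∀ i j, p.b i j ≠ 0 → |δ₀ i - δ₀ j| ≤ θ) {h : ℝ} (hh : 0 < h)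
    {x : (Fin n → ℝ) × (Fin n → ℝ)} (hx : x ∈ constraintSet p δ₀)
    (hP : ∀ i j, p.b i j ≠ 0 → |x.1 i - x.1 j| ≤ π / 2) (i : Fin n) :
    p.D i * (x.1 i - δ₀ i) ^ 2 ≤ vhGain p β θ h / h * phaseEnergy p δ₀ x := by
  set gθ := (1 - Real.sin θ) / (π / 2 - θ) with hgθ
  set SD : ℝ := ∑ i, p.D i with hSD
  set SM : ℝ := ∑ i ∈ p.gen, p.M i with hSM
  set K : ℝ := p.kinetic x.2 with hK
  set Qx : ℝ := (1 / 2) * ∑ i, ∑ j, p.b i j * (((x.1 i - x.1 j) - (δ₀ i - δ₀ j)) ^ 2 / 2)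
    with hQx
  set Φ : ℝ := ∑ i, p.D i * (x.1 i - δ₀ i) ^ 2 with hΦ
  set C := vhGain p β θ h with hC
  have hSDpos : 0 < SD := sum_D_pos hp hn
  have hSM0 : 0 ≤ SM := Finset.sum_nonneg fun i hi => (hp.M_pos i hi).le
  have hg : 0 < gθ := SinusoidalCoupling.sectorGain_pos hθ0 hθ
  have hK0 : 0 ≤ K := p.kinetic_nonneg (fun i hi => (hp.M_pos i hi).le) x.2
  have hQ0 : 0 ≤ Qx := p.quadraticGap_nonneg hb δ₀ x.1
  -- one term is below the sum
  have hterm : p.D i * (x.1 i - δ₀ i) ^ 2 ≤ Φ :=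
    Finset.single_le_sum (f := fun j => p.D j * (x.1 j - δ₀ j) ^ 2)
      (fun j _ => mul_nonneg (hp.D_pos j).le (sq_nonneg _)) (Finset.mem_univ i)
  -- leaf Poincaré
  have hB := sum_D_sq_le_of_mem_constraintSet hp hn hconn hb hβ hβb hx
  rw [← hΦ, ← hQx, ← hSD, ← hSM, ← hK] at hB
  -- g Q ≤ W, V = K + W
  have hW : gθ * Qx ≤ p.potential δ₀ x.1 := p.potential_ge_quadratic hb hθ0 hθ h0 hP
  have hV : phaseEnergy p δ₀ x = K + p.potential δ₀ x.1 := rfl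
  have hW0 : 0 ≤ p.potential δ₀ x.1 := le_trans (mul_nonneg hg.le hQ0) hW
  -- the two gain comparisons
  have hC1 : 2 + 2 * h * SM / SD ≤ C := by rw [hC]; unfold vhGain; rw [← hSD, ← hSM]; exact le_max_left _ _
  have hC2 : (1 + 4 * h * (n : ℝ) ^ 2 * SD / β) / gθ ≤ C := by
    rw [hC]; unfold vhGain; rw [← hSD, ← hSM, ← hgθ]; exact le_max_right _ _
  have hA : h * (4 * (n : ℝ) ^ 2 * SD / β) * Qx ≤ C * p.potential δ₀ x.1 := by
    -- h·A·Q = (h·A/g)·(gQ) ≤ ((1 + hA)/g)·W ≤ C·W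
    have hgQ0 : 0 ≤ gθ * Qx := mul_nonneg hg.le hQ0
    have e : h * (4 * (n : ℝ) ^ 2 * SD / β) * Qx = (h * (4 * (n : ℝ) ^ 2 * SD / β) / gθ) * (gθ * Qx) := by
      field_simp
    have hle : h * (4 * (n : ℝ) ^ 2 * SD / β) / gθ ≤ (1 + 4 * h * (n : ℝ) ^ 2 * SD / β) / gθ := by
      apply div_le_div_of_nonneg_right _ hg.le
      have e2 : h * (4 * (n : ℝ) ^ 2 * SD / β) = 4 * h * (n : ℝ) ^ 2 * SD / β := by ring
      rw [e2]
      linarith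
    have hC0 : 0 ≤ C := le_trans (by positivity) hC1
    rw [e]
    calc h * (4 * (n : ℝ) ^ 2 * SD / β) / gθ * (gθ * Qx)
        ≤ (1 + 4 * h * (n : ℝ) ^ 2 * SD / β) / gθ * (gθ * Qx) := mul_le_mul_of_nonneg_right hle hgQ0
      _ ≤ C * (gθ * Qx) := mul_le_mul_of_nonneg_right hC2 hgQ0
      _ ≤ C * p.potential δ₀ x.1 := mul_le_mul_of_nonneg_left hW hC0
  have hBK : h * (2 * SM / SD) * K ≤ C * K := by
    refine mul_le_mul_of_nonneg_right ?_ hK0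
    have : 0 ≤ 2 * h * SM / SD := by positivity
    have e : h * (2 * SM / SD) = 2 * h * SM / SD := by ring
    rw [e]; linarith
  -- assemble: h·Dᵢφᵢ² ≤ h·Φ ≤ C·V
  have hmain : h * (p.D i * (x.1 i - δ₀ i) ^ 2) ≤ C * phaseEnergy p δ₀ x := by
    have h1 : h * (p.D i * (x.1 i - δ₀ i) ^ 2) ≤ h * Φ := mul_le_mul_of_nonneg_left hterm hh.le
    have h2 : h * Φ ≤ h * (4 * (n : ℝ) ^ 2 * SD / β) * Qx + h * (2 * SM / SD) * K := by
      have := mul_le_mul_of_nonneg_left hB hh.le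
      have e : h * (4 * (n : ℝ) ^ 2 * SD / β * Qx + 2 * SM / SD * K)
          = h * (4 * (n : ℝ) ^ 2 * SD / β) * Qx + h * (2 * SM / SD) * K := by ring
      rw [e] at this; exact this
    rw [hV, mul_add]
    linarith
  rw [div_mul_eq_mul_div, le_div_iff₀ hh, mul_comm]
  exact hmain

/-! ### Exponential convergence of the state along solutions from the certified region -/

/-- **Every bus angle converges exponentially at rate `vhRate/2`** on the certified region of record:
under the data of `phaseEnergy_le_mul_exp_neg_of_sublevel`, along every global solution `X` from
`S = {V ≤ c} ∩ window ∩ leaf`, for all `t ≥ 0` and every bus `i`: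
`|δᵢ(t) − δ₀ᵢ| ≤ vhGain·√(3·V(X 0)/(h·Dᵢ))·exp(−(vhRate/2)·t)`. MODEL MV-3; no sentence here says a grid
is stable or well damped. [cite: Khalil2002, Theorem 4.10 and Definition 4.5] -/
theorem abs_angle_sub_le_of_sublevel {p : Params n} (hp : p.WellFormed) (hn : n ≠ 0)
    (hconn : p.couplingGraph.Preconnected) (hb : ∀ i j, 0 ≤ p.b i j) {β : ℝ} (hβ : 0 < β)
    (hβb : ∀ i j, p.couplingGraph.Adj i j → β ≤ p.b i j)
    {δ₀ : Fin n → ℝ} {θ : ℝ} (hθ0 : 0 ≤ θ) (hθ : θ < π / 2)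
    (h0 : ∀ i j, p.b i j ≠ 0 → |δ₀ i - δ₀ j| ≤ θ) (hδ₀ : p.IsSyncEquilibrium δ₀)
    {c : ℝ} (hc : c < levelBound θ β) {h : ℝ} (hh : 0 < h)
    (hhM : ∀ i ∈ p.gen, 2 * h * p.M i ≤ p.D i)
    {X : ℝ → (Fin n → ℝ) × (Fin n → ℝ)}
    (hX0 : X 0 ∈ window p ∩ constraintSet p δ₀ ∧ phaseEnergy p δ₀ (X 0) ≤ c)
    (hX : ∀ T : ℝ, ∀ t ∈ Icc 0 T, HasDerivWithinAt X (phaseField p (X t)) (Icc 0 T) t)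
    {t : ℝ} (ht : 0 ≤ t) (i : Fin n) :
    |(X t).1 i - δ₀ i|
      ≤ vhGain p β θ h * Real.sqrt (3 * phaseEnergy p δ₀ (X 0) / (h * p.D i))
        * Real.exp (-(vhRate p β θ h / 2) * t) := by
  obtain ⟨-, hall⟩ := sublevel_subset_regionOfAttraction hp hn hconn hb hβ hβb hθ0 hθ h0 hδ₀ hc hX0
  obtain ⟨hstay, -⟩ := hall X rfl hX
  have hmem := hstay t ht
  have hdec := phaseEnergy_le_mul_exp_neg_of_sublevel hp hn hconn hb hβ hβb hθ0 hθ h0 hδ₀ hc hh hhM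
    hX0 hX ht
  have hsq := D_mul_sq_le_vhGain_div_mul_phaseEnergy hp hn hconn hb hβ hβb hθ0 hθ h0 hh hmem.1.2
    (fun a c hac => (hmem.1.1 a c hac).le) i
  set G := vhGain p β θ h with hG
  set V0 := phaseEnergy p δ₀ (X 0) with hV0
  have hDi := hp.D_pos i
  have hG0 : 0 ≤ G := le_trans (by norm_num) (two_le_vhGain hp hn hh.le (β := β) (θ := θ))
  -- V(X 0) ≥ 0 on the window
  have hV00 : 0 ≤ V0 := by
    have h0' : ∀ a c, p.b a c ≠ 0 → |δ₀ a - δ₀ c| ≤ π / 2 := fun a c hac => (h0 a c hac).trans hθ.le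
    refine p.energy_nonneg hp hb h0' (fun a c hac => ?_) (X 0).2
    have h1 := abs_lt.1 (hX0.1.1 a c hac)
    have h2 := abs_le.1 (h0' a c hac)
    exact abs_le.2 ⟨by linarith [h1.1, h2.1], by linarith [h1.2, h2.2]⟩
  -- φᵢ² ≤ (3G²V0/(hDᵢ))·e^{−ρt}
  have h1 : p.D i * ((X t).1 i - δ₀ i) ^ 2
      ≤ G / h * (3 * G * V0 * Real.exp (-vhRate p β θ h * t)) :=
    hsq.trans (mul_le_mul_of_nonneg_left hdec (div_nonneg hG0 hh.le))
  have hB0 : 0 ≤ G ^ 2 * (3 * V0 / (h * p.D i)) := by positivity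
  have hφ2 : ((X t).1 i - δ₀ i) ^ 2
      ≤ (G ^ 2 * (3 * V0 / (h * p.D i))) * Real.exp (-vhRate p β θ h * t) := by
    have e : (G ^ 2 * (3 * V0 / (h * p.D i))) * Real.exp (-vhRate p β θ h * t)
        = (G / h * (3 * G * V0 * Real.exp (-vhRate p β θ h * t))) / p.D i := by
      field_simp
    rw [e, le_div_iff₀ hDi]
    linarith
  have habs := abs_le_sqrt_mul_exp_of_sq_le hB0 hφ2
  have hsqrt : Real.sqrt (G ^ 2 * (3 * V0 / (h * p.D i))) = G * Real.sqrt (3 * V0 / (h * p.D i)) := by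
    rw [Real.sqrt_mul (sq_nonneg G), Real.sqrt_sq hG0]
  rw [hsqrt] at habs
  exact habs

/-- **Every generator frequency deviation converges exponentially at rate `vhRate/2`** on the certified
region of record: under the same data, for all `t ≥ 0` and every generator `i`:
`|ωᵢ(t)| ≤ √(6·vhGain·V(X 0)/Mᵢ)·exp(−(vhRate/2)·t)` (`½Mᵢωᵢ² ≤ K ≤ V(X t)` since `W ≥ 0` on the window).
MODEL MV-3; no sentence here says a grid is stable or well damped.
[cite: Khalil2002, Theorem 4.10 and Definition 4.5] -/
theorem abs_speed_le_of_sublevel {p : Params n} (hp : p.WellFormed) (hn : n ≠ 0)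
    (hconn : p.couplingGraph.Preconnected) (hb : ∀ i j, 0 ≤ p.b i j) {β : ℝ} (hβ : 0 < β)
    (hβb : ∀ i j, p.couplingGraph.Adj i j → β ≤ p.b i j)
    {δ₀ : Fin n → ℝ} {θ : ℝ} (hθ0 : 0 ≤ θ) (hθ : θ < π / 2)
    (h0 : ∀ i j, p.b i j ≠ 0 → |δ₀ i - δ₀ j| ≤ θ) (hδ₀ : p.IsSyncEquilibrium δ₀)
    {c : ℝ} (hc : c < levelBound θ β) {h : ℝ} (hh : 0 < h)
    (hhM : ∀ i ∈ p.gen, 2 * h * p.M i ≤ p.D i)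
    {X : ℝ → (Fin n → ℝ) × (Fin n → ℝ)}
    (hX0 : X 0 ∈ window p ∩ constraintSet p δ₀ ∧ phaseEnergy p δ₀ (X 0) ≤ c)
    (hX : ∀ T : ℝ, ∀ t ∈ Icc 0 T, HasDerivWithinAt X (phaseField p (X t)) (Icc 0 T) t)
    {t : ℝ} (ht : 0 ≤ t) {i : Fin n} (hi : i ∈ p.gen) :
    |(X t).2 i|
      ≤ Real.sqrt (6 * vhGain p β θ h * phaseEnergy p δ₀ (X 0) / p.M i)
        * Real.exp (-(vhRate p β θ h / 2) * t) := by
  obtain ⟨-, hall⟩ := sublevel_subset_regionOfAttraction hp hn hconn hb hβ hβb hθ0 hθ h0 hδ₀ hc hX0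
  obtain ⟨hstay, -⟩ := hall X rfl hX
  have hmem := hstay t ht
  have hdec := phaseEnergy_le_mul_exp_neg_of_sublevel hp hn hconn hb hβ hβb hθ0 hθ h0 hδ₀ hc hh hhM
    hX0 hX ht
  set G := vhGain p β θ h with hG
  set V0 := phaseEnergy p δ₀ (X 0) with hV0
  have hMi := hp.M_pos i hi
  have hG0 : 0 ≤ G := le_trans (by norm_num) (two_le_vhGain hp hn hh.le (β := β) (θ := θ))
  have h0' : ∀ a c, p.b a c ≠ 0 → |δ₀ a - δ₀ c| ≤ π / 2 := fun a c hac => (h0 a c hac).trans hθ.le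
  -- V(X 0) ≥ 0 and W(X t) ≥ 0 on the window
  have hclosed : ∀ s, 0 ≤ s → ∀ a c, p.b a c ≠ 0 →
      |((X s).1 a - (X s).1 c) + (δ₀ a - δ₀ c)| ≤ π := by
    intro s hs a c hac
    have h1 := abs_lt.1 ((hstay s hs).1.1 a c hac)
    have h2 := abs_le.1 (h0' a c hac)
    exact abs_le.2 ⟨by linarith [h1.1, h2.1], by linarith [h1.2, h2.2]⟩
  have hV00 : 0 ≤ V0 := p.energy_nonneg hp hb h0' (hclosed 0 le_rfl) (X 0).2
  have hWt : 0 ≤ p.potential δ₀ (X t).1 := p.potential_nonneg hb h0' (hclosed t ht)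
  -- ½Mᵢωᵢ² ≤ K ≤ V(X t) ≤ 3·G·V0·e^{−ρt}
  have hK := p.half_M_mul_sq_le_kinetic (fun j hj => (hp.M_pos j hj).le) (X t).2 hi
  have hVt : phaseEnergy p δ₀ (X t) = p.kinetic (X t).2 + p.potential δ₀ (X t).1 := rfl
  have h1 : (1 / 2) * (p.M i * (X t).2 i ^ 2) ≤ 3 * G * V0 * Real.exp (-vhRate p β θ h * t) := by
    linarith
  have hB0 : 0 ≤ 6 * G * V0 / p.M i := by positivity
  have hω2 : (X t).2 i ^ 2 ≤ (6 * G * V0 / p.M i) * Real.exp (-vhRate p β θ h * t) := by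
    have e : (6 * G * V0 / p.M i) * Real.exp (-vhRate p β θ h * t)
        = (2 * (3 * G * V0 * Real.exp (-vhRate p β θ h * t))) / p.M i := by
      field_simp
      ring
    rw [e, le_div_iff₀ hMi]
    nlinarith
  exact abs_le_sqrt_mul_exp_of_sq_le hB0 hω2

/-! ### Back to the printed second-order form -/

/-- **«SP-RATE» in coordinates, printed vocabulary (frame rotating at `ω₀`).** Under the data of
`phaseEnergy_le_mul_exp_neg_of_sublevel`, every solution `δ` of the shifted structure-preserving model in
model-2's second-order sense (`p.shifted.IsSolution δ`) whose initial state has every coupled branch inside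
`|δᵢ(0) − δⱼ(0)| < π/2`, momentum `L(δ(0), δ̇(0)) = L(δ₀, 0)` and energy `V₀ = V(δ(0), δ̇(0)) ≤ c < c⋆(θ, β)`
satisfies, for all `t ≥ 0`: every bus angle `|δᵢ(t) − δ₀ᵢ| ≤ vhGain·√(3V₀/(hDᵢ))·e^{−(vhRate/2)t}` and every
generator frequency deviation `|δ̇ᵢ(t)| ≤ √(6·vhGain·V₀/Mᵢ)·e^{−(vhRate/2)t}` — exponential synchronisation of
MODEL MV-3 with a closed-form rate. No sentence here says a grid is stable or well damped.
[cite: Padiyar2013, §3.2 eqs (3.2)–(3.5), (3.11)]; [cite: Khalil2002, Theorem 4.10 and Definition 4.5] -/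
theorem abs_sub_le_of_isSolution {p : Params n} (hp : p.WellFormed) (hn : n ≠ 0)
    (hconn : p.couplingGraph.Preconnected) (hb : ∀ i j, 0 ≤ p.b i j) {β : ℝ} (hβ : 0 < β)
    (hβb : ∀ i j, p.couplingGraph.Adj i j → β ≤ p.b i j)
    {δ₀ : Fin n → ℝ} {θ : ℝ} (hθ0 : 0 ≤ θ) (hθ : θ < π / 2)
    (h0 : ∀ i j, p.b i j ≠ 0 → |δ₀ i - δ₀ j| ≤ θ) (hδ₀ : p.IsSyncEquilibrium δ₀)
    {c : ℝ} (hc : c < levelBound θ β) {h : ℝ} (hh : 0 < h)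
    (hhM : ∀ i ∈ p.gen, 2 * h * p.M i ≤ p.D i)
    {δ : ℝ → Fin n → ℝ} (hδ : p.shifted.IsSolution δ)
    (hwin : ∀ i j, p.b i j ≠ 0 → |δ 0 i - δ 0 j| < π / 2)
    (hL : p.momentum (δ 0) (fun i => deriv (fun u => δ u i) 0) = p.momentum δ₀ 0)
    (hV : p.energy δ₀ (δ 0) (fun i => deriv (fun u => δ u i) 0) ≤ c) {t : ℝ} (ht : 0 ≤ t) :
    (∀ i, |δ t i - δ₀ i|
        ≤ vhGain p β θ h * Real.sqrt (3 * p.energy δ₀ (δ 0) (fun i => deriv (fun u => δ u i) 0)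
            / (h * p.D i)) * Real.exp (-(vhRate p β θ h / 2) * t)) ∧
      ∀ i ∈ p.gen, |deriv (fun u => δ u i) t|
        ≤ Real.sqrt (6 * vhGain p β θ h * p.energy δ₀ (δ 0) (fun i => deriv (fun u => δ u i) 0)
            / p.M i) * Real.exp (-(vhRate p β θ h / 2) * t) := by
  set X : ℝ → (Fin n → ℝ) × (Fin n → ℝ) :=
    fun s => (δ s, fun i => if i ∈ p.gen then deriv (fun u => δ u i) s else 0) with hXdef
  have hgen : ∀ s, ∀ i ∈ p.gen, (X s).2 i = deriv (fun u => δ u i) s := fun s i hi => by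
    simp [hXdef, hi]
  have hXsol : ∀ T : ℝ, ∀ t ∈ Icc 0 T, HasDerivWithinAt X (phaseField p (X t)) (Icc 0 T) t :=
    fun T t _ => (hasDerivAt_phase_of_isSolution hp hδ t).hasDerivWithinAt
  have hy : X 0 ∈ window p ∩ constraintSet p δ₀ ∧ phaseEnergy p δ₀ (X 0) ≤ c := by
    refine ⟨⟨hwin, ?_, fun i hi => by simp [hXdef, hi]⟩, ?_⟩
    · rw [momentum_congr_gen p (δ 0) (hgen 0)]
      exact hL
    · rw [phaseEnergy_apply, energy_congr_gen p δ₀ (δ 0) (hgen 0)]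
      exact hV
  have hE0 : phaseEnergy p δ₀ (X 0) = p.energy δ₀ (δ 0) (fun i => deriv (fun u => δ u i) 0) := by
    rw [phaseEnergy_apply, energy_congr_gen p δ₀ (δ 0) (hgen 0)]
  refine ⟨fun i => ?_, fun i hi => ?_⟩
  · have h := abs_angle_sub_le_of_sublevel hp hn hconn hb hβ hβb hθ0 hθ h0 hδ₀ hc hh hhM hy hXsol ht i
    rw [hE0] at h
    exact h
  · have h := abs_speed_le_of_sublevel hp hn hconn hb hβ hβb hθ0 hθ h0 hδ₀ hc hh hhM hy hXsol ht hi
    rw [hE0, hgen t i hi] at h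
    exact h

end Summit.Ventures.GridStability.Lyapunov.StructurePreserving

end
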